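import Literature.NumberTheory.ComplexMultiplication.CMOrderIdealPrescribedLocalComponents
import Literature.NumberTheory.ComplexMultiplication.CMOrderWeakEquivalenceSingularPrimes
import HarnessLib

/-!
# `𝔭`-equivalence IS local isomorphism at `𝔭`: MARSEGLIA 2025 PROP. 3.2 (4) ⟹ (2) at a SINGLE maximal ideal —
# `1 ∈ (I:J)(J:I) + 𝔭 ⟹ I_𝔭 = x·J_𝔭` — for the order `𝔯 = endOrder (M_μ)` of a number field of any degree

Family `hodge`, lane `lit-hodgefound` (Track 2 foundations library; seat p15, row g26-#7), topic
`Literature/NumberTheory/ComplexMultiplication`, namespaces `Literature.NumberTheory.ComplexMultiplication.NumberRing`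
(any noetherian domain `R` with fraction field `K`), `…EndOrder` (`𝔯 = endOrder ρ`) and `…CMTypeLattice` (the order
`𝔯 = endOrder (M_μ)` of the lattice spanned by a `ℚ`-basis `μ` of `K`).  THEOREMS ONLY: no definition, no
instance, no named fact (net Literature debt `0`).  Conventions as in `CMOrderWeakEquivalenceLocalIsomorphism` /
`CMOrderWeakEquivalenceSingularPrimes` (g26-#3/#4): `R_𝔭 = Localization.subalgebra.ofField K 𝔭.primeCompl _`,
`N_𝔭 = span R_𝔭 ↑N`, `(I:J) = I / J`, «`I` and `J` are `𝔭`-equivalent» `= 1 ∈ (I:J)(J:I) + 𝔭` (Prop. 3.2 (4)).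

## Source, VERBATIM

S. Marseglia, *Local isomorphism classes of fractional ideals of orders in étale algebras*, J. Algebra 673 (2025)
77–102 [Marseglia2025LocalIsomorphism] (arXiv:2311.18571, held `paper:arxiv-2311.18571`, chunk p0006):
"Definition 3.1. Let `I` and `J` be fractional `R`-ideals and `𝔭` a maximal ideal of `R`. We say that `I` and
`J` are `𝔭`-equivalent if `I_𝔭 ≃ J_𝔭` as `R_𝔭`-modules. Proposition 3.2. Let `I` and `J` be two fractional
`R`-ideals, and let `𝔭` be a maximal ideal of `R`. Then the following statements are equivalent: (1) `I` and `J`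
are `𝔭`-equivalent. (2) There exists a non-zero divisor `α ∈ (I:J)_𝔭` such that `I_𝔭 = αJ_𝔭`.
(3) `(I:J)_𝔭(J:I)_𝔭 = (I:I)_𝔭`. (4) `1 ∈ (I:J)(J:I) + 𝔭`.  Proof. … Assume now that (3) holds. Then `(I:J)_𝔭` is
an invertible `(I:I)_𝔭`-ideal with inverse `(J:I)_𝔭`. Since `(I:I)_𝔭` is semilocal, `(I:J)_𝔭` is a principal
`(I:I)_𝔭`-ideal, say generated by a non-zero divisor `α` … (2) holds as well. …"
and §4, proof of Theorem 4.4, pp. 8–9 (chunk p0008–p0009): "Consider a vector of classes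
`([I₁]_{𝔭₁}, …, [Iₙ]_{𝔭ₙ})` … Put `J = Σ_{i=1}^n ((I_i + 𝔭_i^{k_i}) ∏_{j≠i} 𝔭_j^{k_j})` … `[J]_{𝒮₀}` is a preimage".

The printed step (3) ⟹ (2) localises at `𝔭` and uses «invertible over a semilocal ring ⟹ principal».  Here the
same conclusion is reached GLOBALLY with the landed machinery instead (a genuinely shorter road in the tree's
vocabulary, which has no semilocal ring `(I:I)_𝔭` as a type): replace `J` by the ideal `J′` with local components
`J′_𝔭 = J_𝔭` and `J′_𝔮 = I_𝔮` at the other maximal ideals `𝔮 ⊇ 𝔣` (`CMOrderIdealPrescribedLocalComponents`, the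
eq. (4.1) construction); then `I` and `J′` are `𝔮`-equivalent at every `𝔮 ⊇ 𝔣`, hence weakly equivalent
(`CMOrderWeakEquivalenceSingularPrimes`, Prop. 3.4/3.8), hence locally isomorphic at every prime
(`CMOrderWeakEquivalenceLocalIsomorphism`, Marseglia 2019 Prop. 4.1), and at `𝔭` this reads `I_𝔭 = x·J′_𝔭 = x·J_𝔭`.

## What is formalised

* §1 (noetherian domain) **`NumberRing.span_coe_div_mul_div_eq_of_span_coe_eq_of_span_coe_eq`** (`((I:J)(J:I))_𝔭`
  depends only on `I_𝔭`, `J_𝔭`), `one_mem_add_coeIdeal_iff_of_span_coe_eq_of_span_coe_eq` (so does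
  `𝔭`-equivalence), `mem_span_coe_div_of_span_coe_eq` («`α ∈ (I:J)_𝔭`» in (2)).
* §2 (`𝔯 = endOrder ρ`) **`EndOrder.exists_span_coe_eq_and_one_mem_div_mul_div`**: if `1 ∈ (I:J)(J:I) + 𝔭` at a
  maximal `𝔭 ⊇ 𝔣`, there is `J′ ≠ 0` with `J′_𝔭 = J_𝔭` and `1 ∈ (I:J′)(J′:I)`.
* §3 (`𝔯 = endOrder (M_μ)`) **`CMTypeLattice.exists_ne_zero_span_coe_eq_of_one_mem_add_coeIdeal`** (PROP. 3.2
  (4) ⟹ (2) at one prime), **`exists_ne_zero_span_coe_eq_iff_one_mem_add_coeIdeal`** (PROP. 3.2 (1)/(2) ⟺ (4)),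
  `exists_ne_zero_span_coe_eq_iff_one_mem_span_coe` ((1)/(2) ⟺ «`1 ∈ ((I:J)(J:I))_𝔭`», the localised form of (3)),
  and `exists_mem_span_coe_div_span_coe_eq_of_one_mem_add_coeIdeal` ((4) ⟹ (2) with `α ∈ (I:J)_𝔭`).
-/

open scoped nonZeroDivisors NumberField
open Module FractionalIdeal NumberField

namespace Literature.NumberTheory.ComplexMultiplication

namespace NumberRing

/-! ## §1 `𝔭`-equivalence only depends on the local components at `𝔭` -/

section AnyDomain

variable {R : Type*} [CommRing R] [IsDomain R] {K : Type*} [Field K] [Algebra R K] [IsFractionRing R K]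

/-- **`((I:J)(J:I))_𝔭` depends only on `I_𝔭` and `J_𝔭`**: `((I:J)(J:I))_𝔭 = (I_𝔭:J_𝔭)(J_𝔭:I_𝔭)` (noetherian `R`,
nonzero ideals). [cite: Marseglia2025LocalIsomorphism, §3 Prop. 3.2 (proof, «`N_𝔭 = (I:J)_𝔭(J:I)_𝔭`») and §2
(«`(I:J)_𝔭 = (I_𝔭:J_𝔭)`»), pp. 5–6] -/
theorem span_coe_div_mul_div_eq_of_span_coe_eq_of_span_coe_eq [IsNoetherianRing R]
    {I J I' J' : FractionalIdeal R⁰ K} (hI : I ≠ 0) (hJ : J ≠ 0) (hI' : I' ≠ 0) (hJ' : J' ≠ 0) (𝔭 : Ideal R)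
    [𝔭.IsPrime]
    (hII' : Submodule.span (Localization.subalgebra.ofField K 𝔭.primeCompl 𝔭.primeCompl_le_nonZeroDivisors)
        (I : Set K) =
      Submodule.span (Localization.subalgebra.ofField K 𝔭.primeCompl 𝔭.primeCompl_le_nonZeroDivisors) (I' : Set K))
    (hJJ' : Submodule.span (Localization.subalgebra.ofField K 𝔭.primeCompl 𝔭.primeCompl_le_nonZeroDivisors)
        (J : Set K) =
      Submodule.span (Localization.subalgebra.ofField K 𝔭.primeCompl 𝔭.primeCompl_le_nonZeroDivisors) (J' : Set K)) :
    Submodule.span (Localization.subalgebra.ofField K 𝔭.primeCompl 𝔭.primeCompl_le_nonZeroDivisors)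
        ((I / J * (J / I) : FractionalIdeal R⁰ K) : Set K) =
      Submodule.span (Localization.subalgebra.ofField K 𝔭.primeCompl 𝔭.primeCompl_le_nonZeroDivisors)
        ((I' / J' * (J' / I') : FractionalIdeal R⁰ K) : Set K) := by
  rw [span_coe_mul, span_coe_div hJ, span_coe_div hI, hII', hJJ', ← span_coe_div hJ', ← span_coe_div hI',
    ← span_coe_mul]

/-- **`𝔭`-equivalence depends only on the local components at `𝔭`**: if `I_𝔭 = I′_𝔭` and `J_𝔭 = J′_𝔭` then
`1 ∈ (I:J)(J:I) + 𝔭 ⟺ 1 ∈ (I′:J′)(J′:I′) + 𝔭` (`𝔭` maximal, `R` noetherian). [cite: Marseglia2025LocalIsomorphism,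
§3 Def. 3.1 / Prop. 3.2 ((1) ⟺ (4)), p. 6] -/
theorem one_mem_add_coeIdeal_iff_of_span_coe_eq_of_span_coe_eq [IsNoetherianRing R]
    {I J I' J' : FractionalIdeal R⁰ K} (hI : I ≠ 0) (hJ : J ≠ 0) (hI' : I' ≠ 0) (hJ' : J' ≠ 0) (𝔭 : Ideal R)
    [𝔭.IsMaximal]
    (hII' : Submodule.span (Localization.subalgebra.ofField K 𝔭.primeCompl 𝔭.primeCompl_le_nonZeroDivisors)
        (I : Set K) =
      Submodule.span (Localization.subalgebra.ofField K 𝔭.primeCompl 𝔭.primeCompl_le_nonZeroDivisors) (I' : Set K))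
    (hJJ' : Submodule.span (Localization.subalgebra.ofField K 𝔭.primeCompl 𝔭.primeCompl_le_nonZeroDivisors)
        (J : Set K) =
      Submodule.span (Localization.subalgebra.ofField K 𝔭.primeCompl 𝔭.primeCompl_le_nonZeroDivisors) (J' : Set K)) :
    (1 : K) ∈ I / J * (J / I) + (𝔭 : FractionalIdeal R⁰ K) ↔
      (1 : K) ∈ I' / J' * (J' / I') + (𝔭 : FractionalIdeal R⁰ K) := by
  rw [← one_mem_span_coe_iff_one_mem_add_coeIdeal, ← one_mem_span_coe_iff_one_mem_add_coeIdeal,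
    span_coe_div_mul_div_eq_of_span_coe_eq_of_span_coe_eq hI hJ hI' hJ' 𝔭 hII' hJJ']

/-- **«a non-zero divisor `α ∈ (I:J)_𝔭` such that `I_𝔭 = αJ_𝔭`»: any `x` with `I_𝔭 = x·J_𝔭` lies in
`(I:J)_𝔭 = (I_𝔭:J_𝔭)`** (noetherian `R`, `J ≠ 0`). [cite: Marseglia2025LocalIsomorphism, §3 Prop. 3.2 (2), p. 6] -/
theorem mem_span_coe_div_of_span_coe_eq [IsNoetherianRing R] {I J : FractionalIdeal R⁰ K} (hJ : J ≠ 0)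
    (𝔭 : Ideal R) [𝔭.IsPrime] {x : K}
    (hx : Submodule.span (Localization.subalgebra.ofField K 𝔭.primeCompl 𝔭.primeCompl_le_nonZeroDivisors)
        (I : Set K) =
      Submodule.span (Localization.subalgebra.ofField K 𝔭.primeCompl 𝔭.primeCompl_le_nonZeroDivisors) {x} *
        Submodule.span (Localization.subalgebra.ofField K 𝔭.primeCompl 𝔭.primeCompl_le_nonZeroDivisors)
          (J : Set K)) :
    x ∈ Submodule.span (Localization.subalgebra.ofField K 𝔭.primeCompl 𝔭.primeCompl_le_nonZeroDivisors)
      ((I / J : FractionalIdeal R⁰ K) : Set K) := by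
  rw [span_coe_div hJ, Submodule.mem_div_iff_forall_mul_mem, hx]
  exact fun y hy ↦ Submodule.mul_mem_mul (Submodule.mem_span_singleton_self x) hy

end AnyDomain

end NumberRing

/-! ## §2 The order `𝔯 = endOrder ρ`: moving `J` inside its `𝔭`-class to a weakly equivalent ideal -/

namespace EndOrder

variable {K : Type} [Field K] [NumberField K]
variable {ι : Type} [Fintype ι] [DecidableEq ι] [Nonempty ι] {ρ : K →ₐ[ℚ] Matrix ι ι ℚ}
variable [IsFractionRing (endOrder ρ) K]

/-- **If `I` and `J` are `𝔭`-equivalent at a maximal `𝔭 ⊇ 𝔣`, some `J′ ≠ 0` with the SAME local component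
`J′_𝔭 = J_𝔭` is weakly equivalent to `I`** — take `J′_𝔭 = J_𝔭` and `J′_𝔮 = I_𝔮` at the other maximal `𝔮 ⊇ 𝔣`
(the eq. (4.1) construction of the proof of Thm. 4.4), so that `I`, `J′` are `𝔮`-equivalent at every `𝔮 ⊇ 𝔣`,
which is weak equivalence by Prop. 3.4 / 3.8. [cite: Marseglia2025LocalIsomorphism, §4 Thm. 4.4 (proof), pp. 8–9;
§3 Prop. 3.4 ((4) ⟹ (1)) and Prop. 3.8, p. 6] -/
theorem exists_span_coe_eq_and_one_mem_div_mul_div {I J : FractionalIdeal (endOrder ρ)⁰ K} (hI : I ≠ 0)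
    (hJ : J ≠ 0) {𝔭 : Ideal (endOrder ρ)} [h𝔭 : 𝔭.IsMaximal] (hle : conductorIdeal ρ ≤ 𝔭)
    (h : (1 : K) ∈ I / J * (J / I) + (𝔭 : FractionalIdeal (endOrder ρ)⁰ K)) :
    ∃ J' : FractionalIdeal (endOrder ρ)⁰ K, J' ≠ 0 ∧
      Submodule.span (Localization.subalgebra.ofField K 𝔭.primeCompl 𝔭.primeCompl_le_nonZeroDivisors)
          (J' : Set K) =
        Submodule.span (Localization.subalgebra.ofField K 𝔭.primeCompl 𝔭.primeCompl_le_nonZeroDivisors)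
          (J : Set K) ∧
      (1 : K) ∈ I / J' * (J' / I) := by
  classical
  haveI := CMTypeLattice.isNoetherianRing_endOrder ρ
  haveI := CMTypeLattice.dimensionLEOne_endOrder ρ
  -- the finitely many maximal ideals `𝔮 ⊇ 𝔣`
  set F : Finset (MaximalSpectrum (endOrder ρ)) :=
    (NumberRing.finite_setOf_le (R := endOrder ρ) (conductorIdeal_ne_bot ρ)).toFinset with hF
  have hmemF : ∀ 𝔮 : MaximalSpectrum (endOrder ρ), conductorIdeal ρ ≤ 𝔮.asIdeal → 𝔮 ∈ F := fun 𝔮 h𝔮 ↦ by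
    rw [hF, Set.Finite.mem_toFinset]; exact h𝔮
  set 𝔭₀ : MaximalSpectrum (endOrder ρ) := ⟨𝔭, h𝔭⟩ with h𝔭₀
  -- local data: `J` at `𝔭`, `I` elsewhere
  set N : MaximalSpectrum (endOrder ρ) → FractionalIdeal (endOrder ρ)⁰ K :=
    fun 𝔮 ↦ if 𝔮 = 𝔭₀ then J else I with hN
  have hN0 : ∀ 𝔮 ∈ F, N 𝔮 ≠ 0 := fun 𝔮 _ ↦ by
    simp only [hN]; split_ifs; exacts [hJ, hI]
  obtain ⟨J', hJ'0, hJ'⟩ := exists_ne_zero_forall_span_coe_eq F N hN0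
  have hJ'𝔭 : Submodule.span (Localization.subalgebra.ofField K 𝔭.primeCompl 𝔭.primeCompl_le_nonZeroDivisors)
        (J' : Set K) =
      Submodule.span (Localization.subalgebra.ofField K 𝔭.primeCompl 𝔭.primeCompl_le_nonZeroDivisors)
        (J : Set K) := by
    have h := hJ' 𝔭₀ (hmemF 𝔭₀ hle)
    simp only [hN, if_pos rfl] at h
    exact h
  refine ⟨J', hJ'0, hJ'𝔭, one_mem_div_mul_div_of_forall_one_mem_add_coeIdeal hI hJ'0 fun 𝔮 h𝔮 ↦ ?_⟩
  haveI := 𝔮.isMaximal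
  by_cases h𝔮𝔭 : 𝔮 = 𝔭₀
  · -- at `𝔭`: `J′_𝔭 = J_𝔭`, so `𝔭`-equivalence of `I`, `J′` is that of `I`, `J`
    subst h𝔮𝔭
    exact (NumberRing.one_mem_add_coeIdeal_iff_of_span_coe_eq_of_span_coe_eq hI hJ'0 hI hJ 𝔭 rfl hJ'𝔭).2 h
  · -- at `𝔮 ≠ 𝔭`: `J′_𝔮 = I_𝔮 = 1·J′_𝔮`
    have h𝔮 := hJ' 𝔮 (hmemF 𝔮 h𝔮)
    simp only [hN, if_neg h𝔮𝔭] at h𝔮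
    refine NumberRing.one_mem_add_coeIdeal_of_span_coe_eq hI hJ'0 𝔮.asIdeal (x := 1) ?_
    rw [h𝔮, ← Submodule.one_eq_span, one_mul]

end EndOrder

/-! ## §3 The order `𝔯 = endOrder (M_μ)`: PROPOSITION 3.2 (4) ⟹ (2), and (1)/(2) ⟺ (3)_loc ⟺ (4) -/

namespace CMTypeLattice

variable {K : Type} [Field K] [NumberField K]
variable {ι : Type} [Fintype ι] [DecidableEq ι] (μ : Basis ι ℚ K)
variable [IsFractionRing (endOrder (Algebra.leftMulMatrix μ)) K]

/-- **PROPOSITION 3.2 (4) ⟹ (2) AT A SINGLE PRIME: `𝔭`-equivalent ideals are locally isomorphic at `𝔭` —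
`1 ∈ (I:J)(J:I) + 𝔭 ⟹ I_𝔭 = x·J_𝔭` with `x ∈ K^*`**, for the order `𝔯 = endOrder (M_μ)` of a number field of any
degree and any maximal `𝔭` (at a regular `𝔭 ⊉ 𝔣` every pair of nonzero ideals is locally isomorphic; at `𝔭 ⊇ 𝔣`
via `EndOrder.exists_span_coe_eq_and_one_mem_div_mul_div` and Marseglia 2019 Prop. 4.1 (2) ⟹ (1)).
[cite: Marseglia2025LocalIsomorphism, §3 Prop. 3.2 ((4) ⟹ (3) ⟹ (2)), p. 6] [cite: Marseglia2019, §4 Prop. 4.1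
((2) ⟹ (1)), p. 8] -/
theorem exists_ne_zero_span_coe_eq_of_one_mem_add_coeIdeal [Nonempty ι]
    {I J : FractionalIdeal (endOrder (Algebra.leftMulMatrix μ))⁰ K} (hI : I ≠ 0) (hJ : J ≠ 0)
    (𝔭 : Ideal (endOrder (Algebra.leftMulMatrix μ))) [h𝔭 : 𝔭.IsMaximal]
    (h : (1 : K) ∈ I / J * (J / I) + (𝔭 : FractionalIdeal (endOrder (Algebra.leftMulMatrix μ))⁰ K)) :
    ∃ x : K, x ≠ 0 ∧
      Submodule.span (Localization.subalgebra.ofField K 𝔭.primeCompl 𝔭.primeCompl_le_nonZeroDivisors) (I : Set K) =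
        Submodule.span (Localization.subalgebra.ofField K 𝔭.primeCompl 𝔭.primeCompl_le_nonZeroDivisors) {x} *
          Submodule.span (Localization.subalgebra.ofField K 𝔭.primeCompl 𝔭.primeCompl_le_nonZeroDivisors)
            (J : Set K) := by
  by_cases hle : EndOrder.conductorIdeal (Algebra.leftMulMatrix μ) ≤ 𝔭
  · obtain ⟨J', hJ'0, hJ'𝔭, h1⟩ := EndOrder.exists_span_coe_eq_and_one_mem_div_mul_div hI hJ hle h
    obtain ⟨x, hx0, hx⟩ := (one_mem_div_mul_div_iff_forall_exists_span_coe_eq μ hI hJ'0).1 h1 ⟨𝔭, h𝔭⟩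
    exact ⟨x, hx0, hx.trans (by rw [hJ'𝔭])⟩
  · exact EndOrder.exists_ne_zero_span_coe_eq_of_not_conductorIdeal_le
      (Ring.ne_bot_of_isMaximal_of_not_isField h𝔭 EndOrder.not_isField) hle hI hJ

/-- **PROPOSITION 3.2 (1)/(2) ⟺ (4): `I_𝔭 = x·J_𝔭` for some `x ∈ K^*` iff `1 ∈ (I:J)(J:I) + 𝔭`** (`𝔭` maximal,
`I`, `J ≠ 0`; `𝔯 = endOrder (M_μ)`). [cite: Marseglia2025LocalIsomorphism, §3 Prop. 3.2 ((1) ⟺ (2) ⟺ (4)), p. 6] -/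
theorem exists_ne_zero_span_coe_eq_iff_one_mem_add_coeIdeal [Nonempty ι]
    {I J : FractionalIdeal (endOrder (Algebra.leftMulMatrix μ))⁰ K} (hI : I ≠ 0) (hJ : J ≠ 0)
    (𝔭 : Ideal (endOrder (Algebra.leftMulMatrix μ))) [𝔭.IsMaximal] :
    (∃ x : K, x ≠ 0 ∧
      Submodule.span (Localization.subalgebra.ofField K 𝔭.primeCompl 𝔭.primeCompl_le_nonZeroDivisors) (I : Set K) =
        Submodule.span (Localization.subalgebra.ofField K 𝔭.primeCompl 𝔭.primeCompl_le_nonZeroDivisors) {x} *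
          Submodule.span (Localization.subalgebra.ofField K 𝔭.primeCompl 𝔭.primeCompl_le_nonZeroDivisors)
            (J : Set K)) ↔
      (1 : K) ∈ I / J * (J / I) + (𝔭 : FractionalIdeal (endOrder (Algebra.leftMulMatrix μ))⁰ K) := by
  haveI := isNoetherianRing_endOrder (Algebra.leftMulMatrix μ)
  exact ⟨fun ⟨x, _, hx⟩ ↦ NumberRing.one_mem_add_coeIdeal_of_span_coe_eq hI hJ 𝔭 hx,
    exists_ne_zero_span_coe_eq_of_one_mem_add_coeIdeal μ hI hJ 𝔭⟩

/-- **PROPOSITION 3.2 (1)/(2) ⟺ «`1 ∈ ((I:J)(J:I))_𝔭`»** (the localised reading of (3): `((I:J)(J:I))_𝔭 = (I:I)_𝔭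
⟺ 1 ∈ ((I:J)(J:I))_𝔭`, `CMOrderPEquivalenceLocalColon`). [cite: Marseglia2025LocalIsomorphism, §3 Prop. 3.2
((2) ⟺ (3)), p. 6] -/
theorem exists_ne_zero_span_coe_eq_iff_one_mem_span_coe [Nonempty ι]
    {I J : FractionalIdeal (endOrder (Algebra.leftMulMatrix μ))⁰ K} (hI : I ≠ 0) (hJ : J ≠ 0)
    (𝔭 : Ideal (endOrder (Algebra.leftMulMatrix μ))) [𝔭.IsMaximal] :
    (∃ x : K, x ≠ 0 ∧
      Submodule.span (Localization.subalgebra.ofField K 𝔭.primeCompl 𝔭.primeCompl_le_nonZeroDivisors) (I : Set K) =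
        Submodule.span (Localization.subalgebra.ofField K 𝔭.primeCompl 𝔭.primeCompl_le_nonZeroDivisors) {x} *
          Submodule.span (Localization.subalgebra.ofField K 𝔭.primeCompl 𝔭.primeCompl_le_nonZeroDivisors)
            (J : Set K)) ↔
      (1 : K) ∈ Submodule.span (Localization.subalgebra.ofField K 𝔭.primeCompl 𝔭.primeCompl_le_nonZeroDivisors)
        ((I / J * (J / I) : FractionalIdeal (endOrder (Algebra.leftMulMatrix μ))⁰ K) : Set K) := by
  rw [exists_ne_zero_span_coe_eq_iff_one_mem_add_coeIdeal μ hI hJ, NumberRing.one_mem_span_coe_iff_one_mem_add_coeIdeal]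

/-- **PROPOSITION 3.2 (4) ⟹ (2) with «`α ∈ (I:J)_𝔭`»: `1 ∈ (I:J)(J:I) + 𝔭 ⟹ I_𝔭 = α·J_𝔭` for some nonzero
`α ∈ (I:J)_𝔭`.** [cite: Marseglia2025LocalIsomorphism, §3 Prop. 3.2 ((4) ⟹ (2)), p. 6] -/
theorem exists_mem_span_coe_div_span_coe_eq_of_one_mem_add_coeIdeal [Nonempty ι]
    {I J : FractionalIdeal (endOrder (Algebra.leftMulMatrix μ))⁰ K} (hI : I ≠ 0) (hJ : J ≠ 0)
    (𝔭 : Ideal (endOrder (Algebra.leftMulMatrix μ))) [𝔭.IsMaximal]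
    (h : (1 : K) ∈ I / J * (J / I) + (𝔭 : FractionalIdeal (endOrder (Algebra.leftMulMatrix μ))⁰ K)) :
    ∃ x : K, x ≠ 0 ∧
      x ∈ Submodule.span (Localization.subalgebra.ofField K 𝔭.primeCompl 𝔭.primeCompl_le_nonZeroDivisors)
        ((I / J : FractionalIdeal (endOrder (Algebra.leftMulMatrix μ))⁰ K) : Set K) ∧
      Submodule.span (Localization.subalgebra.ofField K 𝔭.primeCompl 𝔭.primeCompl_le_nonZeroDivisors) (I : Set K) =
        Submodule.span (Localization.subalgebra.ofField K 𝔭.primeCompl 𝔭.primeCompl_le_nonZeroDivisors) {x} *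
          Submodule.span (Localization.subalgebra.ofField K 𝔭.primeCompl 𝔭.primeCompl_le_nonZeroDivisors)
            (J : Set K) := by
  haveI := isNoetherianRing_endOrder (Algebra.leftMulMatrix μ)
  obtain ⟨x, hx0, hx⟩ := exists_ne_zero_span_coe_eq_of_one_mem_add_coeIdeal μ hI hJ 𝔭 h
  exact ⟨x, hx0, NumberRing.mem_span_coe_div_of_span_coe_eq hJ 𝔭 hx, hx⟩

end CMTypeLattice

end Literature.NumberTheory.ComplexMultiplication
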